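import Mathlib
import Literature.Computability.AlgebraicComplexity.DivisionSLP
import Summits.MatrixMultiplication.MatrixMultiplication.Theorems.CondensationDistanceCondensationSoundStubSimulation

/-!
# Crux `LongExchangeSound` (stmt-MatrixMultiplication-20136), registered stub `stub_longSimulation`

Route `MatrixMultiplication/LongExchangeCondensation`.  The BOOKKEEPING half of the rung, abstract in the field
`K ⊇ ℂ`, the input set `A` and the coordinate system `P` on column sets: if (a) every ball value is an input or a
constant up to a nonzero scalar, (b) `P J ≠ 0` for `|J| = n`, (c) every octahedron satisfies a three-term exchange
relation and (d) every single-pivot configuration `(J, p, Q, U)` satisfies the long exchange relation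
`P J · P K = Σ_{u ∈ U} ε_u · P (J−p+u) · P (((J∖Q)∪U)−u)`, `K = (J−p−Q) ∪ U`, then along every VALID weighted
derivation `(f, g)` (the route's validity predicate verbatim: step `i` is octahedral with `g i = 1`, or a long step
of arity `g i ≥ 2`) the set `{P (f i)}` is `Derivable ℂ (Σ_i (2·g i + 3))` from `A` in the division-SLP model of
`Literature/…/DivisionSLP.lean` (BCS 1997, Def. (4.4)/(4.7)).

* `derivable_add_sum_smul`: an available element plus a `k`-term linear combination of available elements costs
  `k` linear-combination steps (the scalars are free).
* `long_exchange_steps`: one long step with `|U| = s+1 ≥ 2` summands is `s+1` products, `s` linear combinations,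
  one inverse and one product = `2(s+1)+1 = 2s+3` `DivStep`s, even when the `2s+3` premises are available only up
  to nonzero scalars (absorbed into the free scalars), with EXACT output `P J`.
* `stub_simulationWeighted` = the registered signature: induction on a prefix length `k ≤ l` with the invariant
  `|f i| = n`, cost `Σ_{i<k} (2·g i + 3)`; the octahedral case is the floor's `octahedron_five_steps` verbatim.
-/

set_option linter.dupNamespace false

namespace Summit.MatrixMultiplication.MatrixMultiplication.Theorems.LongExchangeSound

open scoped BigOperators
open Literature.Computability.AlgebraicComplexity (Derivable DivStep DivSeq)
open Summit.MatrixMultiplication.MatrixMultiplication.Theorems.CondensationSound (octahedron_five_steps)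

/-- **Accumulating a linear combination.**  If `x` and the `m u` (`u ∈ s`) are available (in `A` or constants),
then `x + Σ_{u ∈ s} κ_u • m u` is derivable from `A` in `|s|` steps (one binary linear combination per summand;
the scalars `κ_u ∈ ℂ` are free in the model). [cite: BurgisserClausenShokrollahi1997, Def. (4.4)] -/
theorem derivable_add_sum_smul {K : Type} [Field K] [Algebra ℂ K] {ι : Type} [DecidableEq ι]
    (s : Finset ι) (κ : ι → ℂ) (m : ι → K) :
    ∀ (A : Set K) (x : K), x ∈ A ∪ Set.range (algebraMap ℂ K) →
      (∀ u ∈ s, m u ∈ A ∪ Set.range (algebraMap ℂ K)) →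
        Derivable ℂ s.card A {x + ∑ u ∈ s, κ u • m u} := by
  induction s using Finset.induction_on with
  | empty =>
    intro A x hx _
    refine Derivable.of_subset ?_ _
    simpa using hx
  | insert u s hu ih =>
    intro A x hx hm
    have s1 : Derivable ℂ 1 A {(1 : ℂ) • x + κ u • m u} :=
      Derivable.lin hx (hm u (Finset.mem_insert_self u s)) 1 (κ u)
    have hx' : (1 : ℂ) • x + κ u • m u ∈ (A ∪ {(1 : ℂ) • x + κ u • m u}) ∪ Set.range (algebraMap ℂ K) :=
      Or.inl (Or.inr rfl)
    have hm' : ∀ v ∈ s, m v ∈ (A ∪ {(1 : ℂ) • x + κ u • m u}) ∪ Set.range (algebraMap ℂ K) := by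
      intro v hv
      rcases hm v (Finset.mem_insert_of_mem hv) with h | h
      · exact Or.inl (Or.inl h)
      · exact Or.inr h
    have s12 := s1.trans (ih _ _ hx' hm')
    have heq : x + ∑ v ∈ insert u s, κ v • m v = (1 : ℂ) • x + κ u • m u + ∑ v ∈ s, κ v • m v := by
      rw [Finset.sum_insert hu, one_smul, add_assoc]
    rw [heq, Finset.card_insert_of_notMem hu]
    exact s12.mono (by omega) subset_rfl subset_rfl

/-- **One long exchange step = `2|U|+1` Ω-steps, with twisted premises.**  In a field `K ⊇ ℂ`: if for `u ∈ U`
(`|U| ≥ 2`) the premises `a' u, b' u` and the divisor premise `e'` are available (in `A` or constants), the true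
coordinates are scalar multiples `a u = α_u • a' u`, `b u = β_u • b' u`, `e = η • e'` with `e ≠ 0`, and
`t · e = Σ_{u ∈ U} c_u · (a u · b u)`, then `t` itself is derivable from `A` in `2|U|+1` steps: `|U|` products
`a' u · b' u`, `|U|−1` linear combinations (scalars `c_u α_u β_u / η`), one inverse `e'⁻¹`, one product.
[cite: BurgisserClausenShokrollahi1997, Def. (4.4)] -/
theorem long_exchange_steps {K : Type} [Field K] [Algebra ℂ K] {ι : Type} [DecidableEq ι] {A : Set K}
    (U : Finset ι) (hU : 2 ≤ U.card) {t e e' : K} {a b a' b' : ι → K} {α β c : ι → ℂ} {η : ℂ}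
    (ha : ∀ u ∈ U, a' u ∈ A ∪ Set.range (algebraMap ℂ K))
    (hb : ∀ u ∈ U, b' u ∈ A ∪ Set.range (algebraMap ℂ K))
    (he : e' ∈ A ∪ Set.range (algebraMap ℂ K))
    (hα : ∀ u ∈ U, a u = α u • a' u) (hβ : ∀ u ∈ U, b u = β u • b' u) (hη : e = η • e') (he0 : e ≠ 0)
    (rel : t * e = ∑ u ∈ U, c u • (a u * b u)) :
    Derivable ℂ (2 * U.card + 1) A {t} := by
  classical
  -- the free scalars and the products
  let κ : ι → ℂ := fun u => c u * α u * β u * η⁻¹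
  let m : ι → K := fun u => a' u * b' u
  set S : K := ∑ u ∈ U, κ u • m u with hS
  -- the twists of the divisor are nonzero
  have hη0 : η ≠ 0 := by
    rintro rfl
    exact he0 (by rw [hη, zero_smul])
  have he'0 : e' ≠ 0 := by
    rintro rfl
    exact he0 (by rw [hη, smul_zero])
  -- the exact value of `t` in terms of the available premises
  have hsum : ∑ u ∈ U, c u • (a u * b u) = η • S := by
    rw [hS, Finset.smul_sum]
    refine Finset.sum_congr rfl fun u hu => ?_
    rw [hα u hu, hβ u hu, smul_mul_smul_comm, smul_smul, smul_smul]
    congr 1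
    simp only [κ]
    field_simp
  have ht : t = S * e'⁻¹ := by
    have h1 : t = t * e * e⁻¹ := (mul_inv_cancel_right₀ he0 t).symm
    have hηK : algebraMap ℂ K η ≠ 0 := by
      rw [Ne, map_eq_zero_iff _ (algebraMap ℂ K).injective]
      exact hη0
    rw [h1, rel, hsum, hη]
    simp only [Algebra.smul_def, mul_inv]
    field_simp
  -- steps 1 … |U|: the products
  have D1 : Derivable ℂ U.card A (⋃ u ∈ U, {m u}) := by
    rw [Finset.card_eq_sum_ones]
    exact Derivable.biUnion U fun u hu => Derivable.mul (ha u hu) (hb u hu)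
  have hmem : ∀ u ∈ U, m u ∈ (A ∪ ⋃ u ∈ U, {m u}) ∪ Set.range (algebraMap ℂ K) := by
    intro u hu
    refine Or.inl (Or.inr ?_)
    simp only [Set.mem_iUnion, Set.mem_singleton_iff]
    exact ⟨u, hu, rfl⟩
  -- steps |U|+1 … 2|U|−1: the linear combination `S`, seeded with two summands
  obtain ⟨u₀, hu₀⟩ : U.Nonempty := Finset.card_pos.mp (by omega)
  have hU₁ : (U.erase u₀).Nonempty := Finset.card_pos.mp (by rw [Finset.card_erase_of_mem hu₀]; omega)
  obtain ⟨u₁, hu₁⟩ := hU₁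
  have hu₁U : u₁ ∈ U := Finset.mem_of_mem_erase hu₁
  set U₂ := (U.erase u₀).erase u₁ with hU₂
  have hU₂c : U₂.card = U.card - 2 := by
    rw [hU₂, Finset.card_erase_of_mem hu₁, Finset.card_erase_of_mem hu₀]
    omega
  have hU₂sub : ∀ u ∈ U₂, u ∈ U := fun u hu =>
    Finset.mem_of_mem_erase (Finset.mem_of_mem_erase hu)
  have D2a : Derivable ℂ 1 (A ∪ ⋃ u ∈ U, {m u}) {κ u₀ • m u₀ + κ u₁ • m u₁} :=
    Derivable.lin (hmem u₀ hu₀) (hmem u₁ hu₁U) (κ u₀) (κ u₁)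
  have D2b : Derivable ℂ U₂.card ((A ∪ ⋃ u ∈ U, {m u}) ∪ {κ u₀ • m u₀ + κ u₁ • m u₁})
      {κ u₀ • m u₀ + κ u₁ • m u₁ + ∑ u ∈ U₂, κ u • m u} := by
    refine derivable_add_sum_smul U₂ κ m _ _ (Or.inl (Or.inr rfl)) fun u hu => ?_
    rcases hmem u (hU₂sub u hu) with h | h
    · exact Or.inl (Or.inl h)
    · exact Or.inr h
  have hS' : κ u₀ • m u₀ + κ u₁ • m u₁ + ∑ u ∈ U₂, κ u • m u = S := by
    rw [hS, ← Finset.add_sum_erase U _ hu₀, ← Finset.add_sum_erase (U.erase u₀) _ hu₁, hU₂, add_assoc]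
  rw [hS'] at D2b
  have D12 : Derivable ℂ (U.card + (1 + U₂.card)) A {S} := D1.trans (D2a.trans D2b)
  -- step 2|U|: the inverse of the divisor premise; step 2|U|+1: the final product
  have D3 : Derivable ℂ 1 A {e'⁻¹} := Derivable.inv he he'0
  have D123 : Derivable ℂ (U.card + (1 + U₂.card) + 1) A ({S} ∪ {e'⁻¹}) := D12.union D3
  have m₃ : S ∈ (A ∪ ({S} ∪ {e'⁻¹})) ∪ Set.range (algebraMap ℂ K) := Or.inl (Or.inr (Or.inl rfl))
  have m₄ : e'⁻¹ ∈ (A ∪ ({S} ∪ {e'⁻¹})) ∪ Set.range (algebraMap ℂ K) := Or.inl (Or.inr (Or.inr rfl))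
  have D4 : Derivable ℂ 1 (A ∪ ({S} ∪ {e'⁻¹})) {S * e'⁻¹} := Derivable.mul m₃ m₄
  have D := D123.trans D4
  rw [← ht] at D
  exact D.mono (by omega) subset_rfl subset_rfl

/-- **STUB `stub_longSimulation` — valid weighted derivations are division-SLPs, `2·g+3` Ω-steps per step of
arity `g`** (registered stub of crux stmt-MatrixMultiplication-20136; abstract in the field `K`, the input set `A`
and the coordinate system `P`).  If (a) every ball value `P J` (`|J| = n`, at most one element `≥ n`) is an input or
a constant up to a nonzero scalar, (b) `P J ≠ 0` for `|J| = n`, (c) every octahedron satisfies a three-term exchange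
relation and (d) every single-pivot configuration satisfies the long exchange relation, then along every valid
weighted derivation `(f, g)` the set `{P (f i)}` is `Derivable ℂ (Σ_i (2·g i + 3))` from `A`.  Proof: induction on a
prefix length `k ≤ l` with the invariant `|f i| = n`; an octahedral step (`g i = 1`) is `octahedron_five_steps`, a
long step (`g i ≥ 2`, `|U| = g i + 1`) is `long_exchange_steps`, chained by `Derivable.trans`.
[cite: BurgisserClausenShokrollahi1997, Def. (4.7)] -/
theorem stub_longSimulation :
    ∀ (K : Type) [Field K] [Algebra ℂ K] (A : Set K) (n m' : ℕ) (P : Finset (Fin (n + m')) → K), (∀ J : Finset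
      (Fin (n + m')), J.card = n → (J.filter fun x : Fin (n + m') => n ≤ x.val).card ≤ 1 → ∃ ε : ℂ, ε ≠ 0 ∧ ε • P
      J ∈ A ∪ Set.range (algebraMap ℂ K)) → (∀ J : Finset (Fin (n + m')), J.card = n → P J ≠ 0) → (∀ (J : Finset
      (Fin (n + m'))) (p q u v : Fin (n + m')), J.card = n → p ∈ J → q ∈ J → p ≠ q → u ∉ J → v ∉ J → u ≠ v → ∃ ε₁
      ε₂ : ℂ, P J * P (insert u (insert v ((J.erase p).erase q))) = ε₁ • (P (insert u (J.erase p)) * P (insert v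
      (J.erase q))) + ε₂ • (P (insert v (J.erase p)) * P (insert u (J.erase q)))) → (∀ (J Q U : Finset (Fin (n +
      m'))) (p : Fin (n + m')), J.card = n → p ∈ J → Q ⊆ J.erase p → (∀ u ∈ U, u ∉ J) → U.card = Q.card + 1 → ∃ ε
      : Fin (n + m') → ℂ, P J * P ((J.erase p \ Q) ∪ U) = ∑ u ∈ U, ε u • (P (insert u (J.erase p)) * P (((J \ Q) ∪
      U).erase u))) → ∀ (l : ℕ) (f : Fin l → Finset (Fin (n + m'))) (g : Fin l → ℕ), (∀ i : Fin l, (g i = 1 ∧ ∃ p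
      ∈ f i, ∃ q ∈ f i, p ≠ q ∧ ∃ u ∉ f i, ∃ v ∉ f i, u ≠ v ∧ ∀ J ∈ [insert u ((f i).erase p), insert v ((f
      i).erase p), insert u ((f i).erase q), insert v ((f i).erase q), insert u (insert v (((f i).erase p).erase
      q))], (J.card = n ∧ (J.filter fun x : Fin (n + m') => n ≤ x.val).card ≤ 1) ∨ ∃ j : Fin l, j < i ∧ f j = J) ∨
      (2 ≤ g i ∧ (f i).card = n ∧ ∃ p ∈ f i, ∃ Q ⊆ (f i).erase p, Q.card = g i ∧ ∃ U : Finset (Fin (n + m')), (∀ u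
      ∈ U, u ∉ f i) ∧ U.card = g i + 1 ∧ ∀ J ∈ insert (((f i).erase p \ Q) ∪ U) (U.image (fun u => insert u ((f
      i).erase p)) ∪ U.image (fun u => ((f i \ Q) ∪ U).erase u)), (J.card = n ∧ (J.filter fun x : Fin (n + m') =>
      n ≤ x.val).card ≤ 1) ∨ ∃ j : Fin l, j < i ∧ f j = J)) →
      Literature.Computability.AlgebraicComplexity.Derivable ℂ (∑ i : Fin l, (2 * g i + 3)) A (Set.range fun i :
      Fin l => P (f i)) := by
  intro K _ _ A n m' P hball hnz hex hlong l f g hvalid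
  classical
  -- `D k` = the values of the first `k` listed sets; `W k` = the weighted length of the first `k` steps
  let D : ℕ → Set K := fun k => {x | ∃ i : Fin l, i.val < k ∧ x = P (f i)}
  let W : ℕ → ℕ := fun k => ∑ i ∈ Finset.univ.filter (fun i : Fin l => i.val < k), (2 * g i + 3)
  have hW : ∀ (k : ℕ) (hk : k < l), W (k + 1) = W k + (2 * g ⟨k, hk⟩ + 3) := by
    intro k hk
    have hflt : Finset.univ.filter (fun i : Fin l => i.val < k + 1) =
        insert ⟨k, hk⟩ (Finset.univ.filter fun i : Fin l => i.val < k) := by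
      ext i
      simp only [Finset.mem_filter, Finset.mem_univ, true_and, Finset.mem_insert, Fin.ext_iff]
      omega
    have hnot : (⟨k, hk⟩ : Fin l) ∉ Finset.univ.filter (fun i : Fin l => i.val < k) := by simp
    simp only [W]
    rw [hflt, Finset.sum_insert hnot, add_comm]
  have hWl : W l = ∑ i : Fin l, (2 * g i + 3) := by
    simp only [W]
    rw [Finset.filter_true_of_mem fun i _ => i.isLt]
  -- every available mate has `n` elements and is available, up to a scalar, over `A ∪ D k`
  have avail : ∀ (k : ℕ) (i : Fin l), i.val = k → (∀ j : Fin l, j.val < k → (f j).card = n) →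
      ∀ J : Finset (Fin (n + m')),
        ((J.card = n ∧ (J.filter fun x : Fin (n + m') => n ≤ x.val).card ≤ 1) ∨ ∃ j : Fin l, j < i ∧ f j = J) →
          J.card = n ∧ ∃ (a : ℂ) (y : K), y ∈ (A ∪ D k) ∪ Set.range (algebraMap ℂ K) ∧ P J = a • y := by
    rintro k i hik hcard J (⟨hJn, hJb⟩ | ⟨j, hj, rfl⟩)
    · obtain ⟨ε, hε, hm⟩ := hball J hJn hJb
      refine ⟨hJn, ε⁻¹, ε • P J, ?_, (inv_smul_smul₀ hε _).symm⟩
      rcases hm with h | h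
      · exact Or.inl (Or.inl h)
      · exact Or.inr h
    · have hjk : j.val < k := by rw [← hik]; exact hj
      exact ⟨hcard j hjk, 1, P (f j), Or.inl (Or.inr ⟨j, hjk, rfl⟩), (one_smul _ _).symm⟩
  have main : ∀ k : ℕ, k ≤ l →
      (∀ i : Fin l, i.val < k → (f i).card = n) ∧ Derivable ℂ (W k) A (D k) := by
    intro k
    induction k with
    | zero =>
      intro _
      refine ⟨fun i hi => absurd hi (Nat.not_lt_zero _), Derivable.of_subset ?_ _⟩
      rintro x ⟨i, hi, -⟩
      exact absurd hi (Nat.not_lt_zero _)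
    | succ k ih =>
      intro hk
      obtain ⟨hcard, hD⟩ := ih (Nat.le_of_succ_le hk)
      let i : Fin l := ⟨k, hk⟩
      have av := avail k i rfl hcard
      -- one step over `A ∪ D k`, of cost `2 * g i + 3`, and the listed set has `n` elements
      have hstep : (f i).card = n ∧ Derivable ℂ (2 * g i + 3) (A ∪ D k) {P (f i)} := by
        rcases hvalid i with ⟨hg1, p, hp, q, hq, hpq, u, hu, v, hv, huv, hmates⟩ |
          ⟨hg2, hcardi, p, hp, Q, hQ, hQc, U, hUJ, hUc, hmates⟩
        · -- octahedral step: the floor's five steps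
          obtain ⟨hc₁, α₁, y₁, hy₁, hP₁⟩ := av (insert u ((f i).erase p)) (hmates _ (by simp))
          obtain ⟨-, α₂, y₂, hy₂, hP₂⟩ := av (insert v ((f i).erase p)) (hmates _ (by simp))
          obtain ⟨-, α₃, y₃, hy₃, hP₃⟩ := av (insert u ((f i).erase q)) (hmates _ (by simp))
          obtain ⟨-, α₄, y₄, hy₄, hP₄⟩ := av (insert v ((f i).erase q)) (hmates _ (by simp))
          obtain ⟨hc₅, α₅, y₅, hy₅, hP₅⟩ :=
            av (insert u (insert v (((f i).erase p).erase q))) (hmates _ (by simp))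
          have hcardi : (f i).card = n := by
            have h1 : (insert u ((f i).erase p)).card = ((f i).erase p).card + 1 :=
              Finset.card_insert_of_notMem fun h => hu (Finset.mem_of_mem_erase h)
            have h2 := Finset.card_erase_of_mem hp
            have h3 : 0 < (f i).card := Finset.card_pos.mpr ⟨p, hp⟩
            omega
          obtain ⟨ε₁, ε₂, hrel⟩ := hex (f i) p q u v hcardi hp hq hpq hu hv huv
          refine ⟨hcardi, ?_⟩
          rw [hg1]
          exact octahedron_five_steps hy₁ hy₄ hy₂ hy₃ hy₅ hP₁ hP₄ hP₂ hP₃ hP₅ (hnz _ hc₅) hrel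
        · -- long step of arity `g i ≥ 2`: `2 (g i + 1) + 1` steps
          obtain ⟨hKc, η, e', he', hPK⟩ := av (((f i).erase p \ Q) ∪ U) (hmates _ (Finset.mem_insert_self _ _))
          have hA : ∀ u, ∃ (α : ℂ) (y : K), u ∈ U →
              (y ∈ (A ∪ D k) ∪ Set.range (algebraMap ℂ K) ∧ P (insert u ((f i).erase p)) = α • y) := by
            intro u
            by_cases hu : u ∈ U
            · obtain ⟨-, α, y, hy, hPy⟩ := av (insert u ((f i).erase p)) (hmates _
                (Finset.mem_insert_of_mem (Finset.mem_union_left _ (Finset.mem_image_of_mem _ hu))))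
              exact ⟨α, y, fun _ => ⟨hy, hPy⟩⟩
            · exact ⟨0, 0, fun h => absurd h hu⟩
          have hB : ∀ u, ∃ (β : ℂ) (y : K), u ∈ U →
              (y ∈ (A ∪ D k) ∪ Set.range (algebraMap ℂ K) ∧ P (((f i \ Q) ∪ U).erase u) = β • y) := by
            intro u
            by_cases hu : u ∈ U
            · obtain ⟨-, β, y, hy, hPy⟩ := av (((f i \ Q) ∪ U).erase u) (hmates _
                (Finset.mem_insert_of_mem (Finset.mem_union_right _ (Finset.mem_image_of_mem _ hu))))
              exact ⟨β, y, fun _ => ⟨hy, hPy⟩⟩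
            · exact ⟨0, 0, fun h => absurd h hu⟩
          choose α a' hαa using hA
          choose β b' hβb using hB
          obtain ⟨ε, hrel⟩ := hlong (f i) Q U p hcardi hp hQ hUJ (by rw [hUc, hQc])
          refine ⟨hcardi, ?_⟩
          have h2 : 2 * g i + 3 = 2 * U.card + 1 := by rw [hUc]; ring
          rw [h2]
          exact long_exchange_steps U (by rw [hUc]; omega) (fun u hu => (hαa u hu).1) (fun u hu => (hβb u hu).1)
            he' (fun u hu => (hαa u hu).2) (fun u hu => (hβb u hu).2) hPK (hnz _ hKc) hrel
      obtain ⟨hcardi, hstep⟩ := hstep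
      refine ⟨fun j hj => ?_, ?_⟩
      · rcases Nat.lt_succ_iff_lt_or_eq.1 hj with hj | hj
        · exact hcard j hj
        · have : j = i := Fin.ext hj
          rw [this]
          exact hcardi
      · have hstep' : Derivable ℂ (0 + (2 * g i + 3)) (A ∪ D k) (D k ∪ {P (f i)}) :=
          (Derivable.of_subset (fun x hx => Or.inl (Or.inr hx)) 0).union hstep
        rw [hW k hk]
        refine (hD.trans hstep').mono (le_of_eq (by dsimp only [i]; omega)) subset_rfl ?_
        rintro x ⟨j, hj, rfl⟩
        rcases Nat.lt_succ_iff_lt_or_eq.1 hj with hj | hj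
        · exact Or.inl ⟨j, hj, rfl⟩
        · have : j = i := Fin.ext hj
          subst this
          exact Or.inr rfl
  rw [← hWl]
  refine (main l le_rfl).2.mono le_rfl subset_rfl ?_
  rintro x ⟨i, rfl⟩
  exact ⟨i, i.isLt, rfl⟩

end Summit.MatrixMultiplication.MatrixMultiplication.Theorems.LongExchangeSound
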